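import Summits.CriticalPhenomena.SAWScalingLimit.Theses.SAWLeftRightFKG

/-!
# Disproof work file for crux `LeftRightFKG` (stmt-CriticalPhenomena-11232, route SAWLeftRightFKG)

Standing adversary: refuter-cdisprove-stmt-CriticalPhenomena-11232 (cycle 1: `-0`; cycle 2: `-g2-0`).  Status after
cycle 2: **NO KILL at `x = x_c`**.  Cycle 2 added (i) a transfer-matrix ALL-PAIRS covariance scan on long strips
(every face event at every cut + first/last-step events, all distances, same- and opposite-side placements, widths
`W = 3…9`: 0 negative pairs out of ~1.2·10⁵), (ii) the CONTINUUM verdict — the exact SLE(8/3) two-point passage law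
(Simmons–Cardy 2009) has covariance `¼ sin v_A sin v_B · g(σ)` with `g > 0`, and hull events obey PA by sub/super-
additivity of a Dirichlet energy (Hadamard variation) — so no large-scale counterexample exists in the scaling limit,
(iii) an exact min-cut (maximum-weight-closure) search over ALL up-set pairs on 10 domains of 25–30 sites (kit j014506),
and (iv) KERNEL-CHECKED Lean: the generic rectangle carrier (`Negative/RectDomain`, `RectMesh`), a certified SAW
enumerator + the fugacity-`x` measure (`Negative/SAWEnum`), and `Negative/Box33.leftRightFKGAt_false`:
`¬ LeftRightFKGAt x` for every `x ≥ 0` with `x⁴ + 2x² > 1` (`x > 0.6436`), in particular `x = 1`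
(`Box33.leftRightFKG_count_false` = the witness of the route's guard `NotFKGAtOne`, stmt-…-11233), axioms
`propext/Classical.choice/Quot.sound` only (proposals filed 2026-08-16, see §3).
Cycle-1 material (boundary adjacency load-bearing, `Negative/WithoutBoundaryAdjacency`, p77992; order
characterisation `wind_nonneg_iff_wcross`, p78135) stands.  Everything numerical below is exact enumeration /
exact transfer matrices unless marked float; cycle-2 scripts: session folder `py/tm.py` (column transfer matrix for
arbitrary column domains, validated against brute force incl. all joint probabilities), `py/tm_strip.py`, `py/bf.py`,
`py/pa.py`, `py/mwc/main.py` (min-cut search, kit), logs `py/scanA_*.log`.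

## 0. What the statement really quantifies over (read-back, `W.lean` rc 0)
* `wind` is the log-lifting winding number, junk `0` on the trace ⇒ `trace C ∩ Ω = ∅`; `Ω` = union of the
  bounded complementary components of `trace C` of non-zero index, each simply connected; `δ` is a dummy
  (everything scales), take `δ = 1`.
* `DomainSAW Ω δ a b` lives on the LARGEST graph component of `ℤ² ∩ Ω` (`meshDomain`); every
  `ℤ²`-neighbour of `V(Ω)` outside `V(Ω)` lies ON the trace.  Hence the instance class is EXACTLY:
  finite `V ⊂ ℤ²`, 4-connected with 4-connected complement ("simply connected vertex animal"),
  `G = ℤ²[V]` induced, `a, b ∈ V` each with a neighbour outside `V` (slits make every such vertex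
  admissible).  Degenerate data (`a ∉ meshDomain`, `a = b`, ties, `C = nil`) give all weights `0` or a
  one-point poset: `0 ≤ 0` / trivial.  **No junk exploit exists.**
* ORDER.  `wind(γ₁·γ₂⁻¹, F) = θ_{γ₁}(F) − θ_{γ₂}(F)` with `θ_γ(F)` = signed crossings of the upward ray
  from the face centre (`2πi·wind = argInc`, additive over the segments of the polyline —
  `Path.argInc_trans/_symm`, `argInc_eq_wind_mul` in `PlaneTopology/ArgumentIncrement.lean`; the
  polyline IS an iterated `Path.trans` of `Path.segment`s, `LatticeInterface.polylineFrom_cons`).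
  So `le γ₁ γ₂ ↔ θ_{γ₁} ≥ θ_{γ₂}` facewise: a genuine partial order (antisymmetric: equal 1-chains ⇒
  equal SAWs; transitive by additivity).  NB orientation: Lean-"up" (the `γ₂` side) = SMALLER `θ`;
  PA is invariant under order reversal (`Cov(1_A,1_B) = Cov(1_{Aᶜ},1_{Bᶜ})`), so all numbers below
  are orientation-free.  Up-sets include the face-level events `{θ(F) ≤ k}`, first/last-step rank
  events, same-side hull avoidances.
* `Cov(1_{first ≥ i}, 1_{last ≥ j}) = Σ` of `2×2` minors of the end-step kernel, each an interlaced
  TP₂ minor of the boundary kernel of `V∖{a,b}` (crux `BoundaryTP2`, stmt-7115).  Continuum value of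
  such a minor = cross-ratio inequality `d₁₁d₂₂ < d₁₂d₂₁` (strict for ANY boundary exponent) ⇒ corner
  margins are `> 0` asymptotically but vanish like `L⁻⁴` at a `π/2` corner (`L⁻²` on a flat side).

## 1. Attacks run (cycle 1) — all at `x_c = 0.3790523`, also at the enclosure ends `1/2.695`, `1/2.6`
* (E1) EXHAUSTIVE: every simply connected animal `≤ 11` vertices, every boundary endpoint pair, EVERY
  pair of up-sets (87 789 posets): `0` violations for `x ∈ {x_c,.40,.42,.44,.46,.48,.50,.55}`; first
  violations at `x = .60` (11 vertices).  With an INTERIOR endpoint allowed: `0` violations `≤ 11` vertices.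
* (E2) boxes `L×L`, corner→corner, family = all face-level up-sets + principal up/down-sets of the
  shortest chords + greedy lattice closure (6×6: 1 262 816 chords): min ratio
  `w(A∩B)w(Ω)/(w(A)w(B))` at `x_c` = 1.153 (3), 1.0340 (4), 1.00837 (5), 1.00178 (6); binding pairs are
  corner-type.  Corner determinant `det = Z_{UL}Z_{RB} − Z_{UB}Z_{RL}` thresholds `x₀(L×L)` =
  .643594, .529883, .486279, .462335 (L = 3..6; 7×7 pending) and strips `W×M`:
  `W=3`: .6436 .5806 .5540 .5394 .5302 .5241 .5197 .5164 .5139 .5120 .5104 .5091 (M=3..14) → `x*(3) ≈ .50`;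
  `W=4`: .5299 .5075 .4951 .4873 .4820 .4782 .4753 .4731 .4713 (M=4..12) → `≈ .464`;
  `W=5`: .4863 .4743 .4667 .4615 .4577 (M=5..9) → `≈ .449`;  `W=6`: .4623 .4547 .4494 (M=6..8) → `≈ .437`.
  TRANSFER MATRIX (cycle 1b, `py/tm.py`, validated against enumeration on 3×3…8×6; 80-digit `Decimal`
  where the relative margin drops below 1e-10): squares `x₀(L×L)` = .643594 .529883 .486279 .462335 .446942
  .436138 .428120 .421931 (L = 3..10) and LONG STRIPS `x*(W) := lim_M x₀(W×M)`
  = .5006 .4604 .4395 .4268 .4184 .413 (W = 3..8, M up to 100):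
      `x₀(L×L) − x_c = 0.91·L^{-4/3}` (±1.5 %, L = 5..10)   and   `x*(W) − x_c = 0.52·W^{-4/3}` (±2 %, W = 3..8),
  i.e. BOTH families of thresholds obey critical finite-size scaling with `1/ν = 4/3` and extrapolate to `x_c`
  EXACTLY, from above; `det(x_c) > 0` with a positive, geometrically decaying ratio in `M` for every `W ≤ 8`
  (real positive odd subleading eigenvalue).  The CFT reading: on a long strip `det ≈ (λ₁λ₂)^M·(−s₂)·κ²`,
  `s₂` = reflection parity of the subleading transfer eigenvector; dilute/critical: the level-1 descendant
  (odd) is subleading ⇒ `det > 0`; dense (`(x−x_c)W^{4/3} ≳ 0.5`): the 3-leg state (`h₃ − h₁ = 1/2 < 1`,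
  even) takes over ⇒ `det < 0`.  So on rectangles the conjecture "switches on exactly at criticality" is
  numerically as solid as such a statement can be; a counterexample, if any, is not a rectangle.
* (E3) zoo of slit / comb / zig-zag / L / neck / band / plus domains, 15–40 vertices, ≤ 1.2·10⁶ chords,
  50 endpoint pairs: no violation; minima `1 + 4·10⁻⁸ … 1.03`; across single-edge cuts the covariance
  FACTORISES, `Cov = det_left · det_right`, and is EXACTLY `0` on the zig-zag domain (tightness, §3).
* (E4) annuli (hole not tied to the boundary — outside the crux class): no violation found
  (min ratios 1.003 – 1.22): simple connectivity looks UNNECESSARY on these instances (info for provers).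
* (E5) fugacity: PA fails for every `x ≥ 0.4495` (8×6 box on `(.4495,.581)`, 6×6 on `(.4625,.6945)`,
  4×4 on `(.5299, ∞)`: `det₄ₓ₄/x¹² = 20 − 24x² − 100x⁴ − 168x⁶ − 208x⁸ − 192x¹⁰ − 64x¹²` is decreasing);
  nothing changes across the proved enclosure `x_c ∈ [1/2.695, 1/2.6]` (margins move by < 3 %).
* (E6) interior endpoints (drop `a' ∈ C.support ∧ b' ∈ C.support`): PA is FALSE FOR EVERY `x > 0`:
  5×4 vertex box, `a = (1,1)`, `b = (3,1)`: the up-sets `{θ(F_{1,0}) ≥ 2}` ("spiral round the face under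
  a") and `{θ(F_{2,0}) ≥ 2}` are non-empty (498 chords; shortest members have length 11) and DISJOINT
  ⇒ `w(A)w(B) > 0 = w(Ω)w(A∩B)`; same on 4×5 `(1,1)→(2,3)`, 5×5 `(1,1)→(3,3)` (179 + 179 of 4330 chords,
  `A = ↑α`, `B = ↑β` principal).  With ONE interior endpoint: tiny negative greedy ratios
  (`1 − 2.8·10⁻⁹` on 6×4 `(1,1)→(4,2)`, float) — boundary adjacency of BOTH marked points is load-bearing.

## 1b. Attacks run (cycle 2) — `x_c = 0.3790523` (and `1/2.6` where stated)
* (E7) TRANSFER-MATRIX ALL-PAIRS SCAN on strips `W × M` (`W` rows), `a`, `b` on the two end columns in every row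
  combination (corner/corner same side, opposite corners, mid/mid, mixed): events = `B_F` = "face `F` lies below `γ`"
  for EVERY interior face of EVERY cut (these are exactly the face-level up-sets: `θ(F)` is two-valued, §0) plus the
  first-step and last-step rank up-sets; ALL pairs, i.e. same cut, different cuts at every distance, same side and
  OPPOSITE sides (the latter probe `Cov_odd − Cov_even`, the only place where Krein-negative even states could win):
  `W=3 (M≤13)`, `4 (16)`, `5 (18)`, `6 (20)`, `7 (22)`, `8 (26)`, `9 (28)`: 276 … 24 088 pairs per geometry, 27 geometries,
  **0 negative covariances**; the minimum normalised covariance is always the END-TO-END pair (maximal distance) and is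
  positive: `2.6e-4 (W3), 1.1e-4 (W4), 8.3e-5 (W5), 6.3e-5 (W6), 4.9e-5 (W7), 1.9e-5 (W8), 1.6e-5 (W9)` — the long-distance
  sign is that of the leading odd state at every width (cycle 1's CFT reading confirmed event-by-event; the even sector
  never dominates at any finite distance either).  (`py/tm_strip.py`, validated pair-by-pair against brute force on
  `3×6, 4×5, 4×6`.)
* (E8) CONTINUUM TWO-POINT TEST (new in kind): for chordal SLE(8/3) in the strip `ℝ × (0,π)` the joint law of the sides
  of two bulk points is known exactly (Simmons–Cardy, J. Phys. A 42 (2009) 235001, arXiv:0811.4767 §6, eq. (P_AB)):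
  `P_AB = ¼[(1+cos v_A)(1+cos v_B) + sin v_A sin v_B (1 − σ ₂F₁(1,4/3;5/3;1−σ))]`, whence
  `Cov(1_A below, 1_B below) = ¼ sin v_A sin v_B · g(σ)`, `g(σ) = 1 − σ ₂F₁(1,4/3;5/3;1−σ) = Σ_{n≥1}(a_{n−1}−a_n)(1−σ)^n`,
  `a_n = Π_{k<n}(4/3+k)/(5/3+k)` decreasing — so `g > 0` on `(0,1)` TERM BY TERM (numerically `g` falls from 1 to 0,
  `g/(1−σ) → 1/5`): bulk point events are positively correlated for EVERY pair of points in the scaling limit.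
  Hull (boundary-bubble) events: `P(γ ∩ A = ∅) = exp(−(5/8)ΔL(A))` (restriction), and PA ⟺ `ΔL` subadditive for
  same-side hulls / superadditive for opposite-side hulls; `π·ΔL` is a Dirichlet-energy increment of the plate
  condenser, subadditive in one plate by `min/max` (strong subadditivity of capacity) and superadditive across plates by
  Hadamard's variation (`|∇v|` on `B` increases when the opposite conductor `A` grows).  With ideator 3's Ward sign for
  marked-point pairs this covers all three event classes: **the scaling limit is PA-consistent; a counterexample at
  `x_c`, if any, is a lattice-scale effect at bounded size** — where (E1)–(E3), (E7), (E9) find none.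
* (E9) EXACT MIN-CUT SEARCH over ALL up-set pairs (kit j013762 smoke 4×4: reproduces `x₀ = .5299`, nothing at `x_c`;
  kit j014506: `5×5` four endpoint geometries, `6×5` diag/side, `6×5` with a top or bottom slit, `7×4`, octagonal `6×6`,
  at `x_c` and `1/2.6`, ~300 seeds × alternating maximum-weight-closure per case) — for a fixed up-set `B` the most
  violating `A` is an exact max-flow computation, so each seed certifies PA against ALL `A` simultaneously; results are
  attached to the item by the job (pending at publication time).
* (E10) LEAN (kernel, no `native_decide`): `¬ LeftRightFKGAt x` for all `x ≥ 0` with `x⁴ + 2x² > 1` — §3(a).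

## 2. Why it resists (for the provers)
(i) small shapes are far from failing (E1: threshold ≥ .55 below 12 vertices); (ii) thresholds fall
only with bulk size, along the finite-size crossover `x₀ − x_c ∼ size^{-1…-4/3}`, and AT `x_c` the sign
is fixed by the continuum cross-ratio / odd-descendant structure; (iii) the margin at `x_c` decays like
`L^{-3…-4}` (corner pairs) and is EXACTLY `0` on single-edge-cut domains — no proof may spend a uniform
`ε`, and any inductive scheme must propagate signs through rank-2 bottlenecks (it does: `Cov` factorises
as a product of two corner determinants of the chambers).

(iv) (cycle 2) in the scaling limit every covariance tested is `≥ 0` with equality only at infinite separation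
(E8), and on the lattice the only vanishing margins are the single-edge-cut factorisations (§1 (E3)) and the
marked-point pairs (`L⁻²…L⁻⁴`); a refutation would have to be a finite-size lattice effect, and the exhaustive /
min-cut / all-pairs searches up to 30 sites and strips up to width 9 see none.  WHERE TO LOOK NEXT (for a later cycle):
events generated by 2–3-step LOCAL PATTERNS at a marked point sitting at a slit tip or reflex corner (non-universal
`L₋₁` amplitudes), tested against bulk faces at distance `2–4`; and kissing-corner principal up-set pairs in necks of
width 3 (the `ℤ²` poset is not a lattice there).

## 3. Contents of this file
(a) `LeftRightFKGAt x` (fugacity as a parameter; `x_c` gives the crux verbatim, `leftRightFKGAt_crit`);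
    `not_leftRightFKGAt_of_sq` — **PROVED in cycle 2** (kernel-checked, session file `lean/Box33.lean` =
    `Theorems/LeftRightFKG/Negative/Box33.lean`, theorem `Box33.leftRightFKGAt_false`, axioms propext / Classical.choice /
    Quot.sound; prerequisites `Negative/RectDomain.lean` (generic rectangle carrier: `Rect.meshVertices_Ω`),
    `Negative/RectMesh.lean` (`Rect.meshDomain_Ω`, `Rect.dAdj_iff`), `Negative/SAWEnum.lean` (`weightAt`, certified DFS
    enumerator `SAWEnum.dfs`/`mem_dfs`); proposals filed 2026-08-16): `¬ LeftRightFKGAt x` for every `x ≥ 0` with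
    `x⁴ + 2x² > 1`, witness the `3 × 3` box `{0,1,2}²`, `a = (0,0)`, `b = (2,2)`, `A = {wcross₀₀ ≥ 1}` = first step up,
    `B = {wcross₁₁ ≥ 1}` = last step from the left, `w(A) = w(B) = 3x⁴+2x⁶+x⁸`, `w(univ) = 6x⁴+4x⁶+2x⁸`, `w(A∩B) = 2x⁴`,
    `w(A)w(B) − w(univ)w(A∩B) = x⁸(3+2x²+x⁴)(x⁴+2x²−1)`; here it is the sorried pointer `not_leftRightFKGAt_of_sq` until
    the modules are built on the farm, plus the corollaries `not_leftRightFKGAt_of_ge` (`x ≥ 0.6436`) and the stronger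
    numerical claim `not_leftRightFKGAt` (`x ≥ 0.4495`, 8×6 box, still sorried: needs a bigger certified enumeration —
    `SAWEnum.dfs` + `decide` will not scale to 48 sites; a `native_decide` census would);
    `Box33.leftRightFKG_count_false` (`x = 1`, counting measure) is EXACTLY the witness the prover of the route's guard
    `NotFKGAtOne` (stmt-CriticalPhenomena-11233) needs (one `exact`);
(b) `LeftRightFKGFree` (endpoint hypotheses dropped) and `leftRightFKGFree_false` (E6, x-free witness)
    — **PROVED** (session folder `NegA.lean`, 1220 lines, rc 0, no sorry, axioms propext /
    Classical.choice / Quot.sound; attached to the item as evidence) as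
    `…Theorems.LeftRightFKG.Negative.leftRightFKG_false_without_boundaryAdjacency`; LANDED as
    `Theorems/LeftRightFKG/Negative/{LatticeSegments (p74952), LatticePolylines (p76216), BoxDomain (p76710),
    BoxMesh (p77096), WithoutBoundaryAdjacency (p77992), OrderCharacterisation (p78135)}.lean` (all accepted);
    `leftRightFKGFree_false` below becomes the one-line corollary as soon as the modules are built on the farm
    (file `Disproof_v5_imports.lean` in the session folder).  KEY REUSABLE LEMMAS (for provers too): the crux's
    ORDER is computable — `wind_poly_probeL`: wind of the lens loop about the centre of face `(m,k)`
    = −(signed crossings of the upward probe); `wcross_le_of_wind_nonneg`: `le γ₁ γ₂ ⇒ wcross m k γ₁ ≤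
    wcross m k γ₂` for every face; `meshDomain_Ωb`/`dAdj_iff`: `Ω_1` of a lattice rectangle is the box;
(c) `exists_crossing_pair_cov_eq_zero` (tightness on a zig-zag domain) — sorried;
(d) Targets: none yet (payload `targets = []`);
(e) near-miss turned into evidence: the strip level-crossing criterion (E2) — thresholds follow `0.52·W^{-4/3}`.
-/

namespace Summit.CriticalPhenomena.SAWScalingLimit.Cruxes.LeftRightFKG.Disproof

open scoped BigOperators ENNReal
open MeasureTheory Literature.Probability.LatticeModels Literature.Probability.RandomPlanarGeometry
  Literature.Topology.PlaneTopology

noncomputable section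

/-- The `x^{|γ|}`-weight on SAWs of `Ω_δ` from `a` to `b` (the crux uses `x = x_c`). [folklore] -/
def weightAt (x : ℝ) (Ω : Set ℂ) (δ : ℝ) (a b : Site 2) : Measure (SAW.DomainSAW Ω δ a b) :=
  Measure.sum fun γ => ENNReal.ofReal (x ^ γ.length) • Measure.dirac γ

/-- At the critical fugacity `weightAt` is the crux's `SAW.weight`, definitionally. [folklore] -/
theorem weightAt_crit (Ω : Set ℂ) (δ : ℝ) (a b : Site 2) :
    weightAt SAW.criticalFugacity Ω δ a b = SAW.weight Ω δ a b := rfl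

/-- `LeftRightFKGAt x`: the crux statement with the fugacity `x_c` replaced by a parameter `x`
(everything else verbatim). [folklore] -/
def LeftRightFKGAt (x : ℝ) : Prop :=
  ∀ (δ : ℝ) (c a b a' b' : Site 2) (C : (zdGraph 2).Walk c c),
    let Ω : Set ℂ := {z | wind (fun t : ℝ => Set.IccExtend zero_le_one (C.toCurve (meshPoint δ)) t - z) ≠ 0}
    let le : SAW.DomainSAW Ω δ a b → SAW.DomainSAW Ω δ a b → Prop := fun γ₁ γ₂ => ∀ z : ℂ,
      0 ≤ wind (fun t : ℝ => Set.IccExtend zero_le_one ((γ₁.walk.append γ₂.walk.reverse).toCurve (meshPoint δ)) t - z)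
    0 < δ → a' ∈ C.support → b' ∈ C.support → (zdGraph 2).Adj a a' → (zdGraph 2).Adj b b' →
    ∀ A B : Set (SAW.DomainSAW Ω δ a b), (∀ γ₁ γ₂, le γ₁ γ₂ → γ₁ ∈ A → γ₂ ∈ A) →
      (∀ γ₁ γ₂, le γ₁ γ₂ → γ₁ ∈ B → γ₂ ∈ B) →
      weightAt x Ω δ a b A * weightAt x Ω δ a b B ≤ weightAt x Ω δ a b Set.univ * weightAt x Ω δ a b (A ∩ B)

/-- The crux is the `x = x_c` instance of `LeftRightFKGAt`. [folklore] -/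
theorem leftRightFKGAt_crit :
    LeftRightFKGAt SAW.criticalFugacity ↔ Theses.SAWLeftRightFKG.LeftRightFKG := Iff.rfl

/-- **(E10, cycle 2) the critical fugacity is load-bearing — kernel-checked form.**  `¬ LeftRightFKGAt x` for
every `x ≥ 0` with `x⁴ + 2x² > 1`: PROVED as `Theorems.LeftRightFKG.Negative.Box33.leftRightFKGAt_false` (3×3 box,
corner events, exact census of the 12 chords by a certified DFS enumeration evaluated by `decide`); this is a sorried
POINTER only because the workfile is published before the farm has built the new modules (then: `exact
Negative.Box33.leftRightFKGAt_false hx0 hx`, the two `weightAt`s agree by `rfl`). [folklore] -/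
theorem not_leftRightFKGAt_of_sq {x : ℝ} (hx0 : 0 ≤ x) (hx : 1 < x ^ 4 + 2 * x ^ 2) : ¬ LeftRightFKGAt x := by
  sorry

/-- Corollary of `not_leftRightFKGAt_of_sq`: association fails for every `x ≥ 0.6436` (the exact threshold of the
3×3 witness is `√(√2 − 1) = 0.64359…`); the arithmetic step is proved here. [folklore] -/
theorem not_leftRightFKGAt_of_ge {x : ℝ} (hx : 0.6436 ≤ x) : ¬ LeftRightFKGAt x := by
  refine not_leftRightFKGAt_of_sq (by linarith) ?_
  have h2 : (0.6436 : ℝ) ^ 2 ≤ x ^ 2 := by nlinarith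
  have h4 : (0.6436 : ℝ) ^ 4 ≤ x ^ 4 := by nlinarith
  have : (1 : ℝ) < 0.6436 ^ 4 + 2 * 0.6436 ^ 2 := by norm_num
  linarith

/-- **(E5) numerically the slack is `< 19 %`:** for every `x ≥ 0.4495` left–right PA fails on some box (8×6 vertices
on `(.4495,.581)`, 6×6 on `(.4625,.6945)`, 4×4 on `[.53, ∞)` where `det/x¹² = 20 − 24x² − 100x⁴ − 168x⁶ − 208x⁸ −
192x¹⁰ − 64x¹²`).  OBSTRUCTION to a Lean proof below `0.6436`: a certified census of the chords of a `≥ 4×4` box —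
`Negative/SAWEnum.dfs` + `decide` handles `3×3` in seconds but the kernel will not evaluate the 184/8512-chord
censuses of `4×4`/`5×5`; `native_decide` would (flag `computational`). [folklore] -/
theorem not_leftRightFKGAt {x : ℝ} (hx : 0.4495 ≤ x) : ¬ LeftRightFKGAt x := by
  sorry

/-- `LeftRightFKGFree`: the crux with the endpoint hypotheses `a' ∈ C.support`, `b' ∈ C.support`,
`Adj a a'`, `Adj b b'` DROPPED (endpoints anywhere in `Ω_δ`), everything else verbatim. [folklore] -/
def LeftRightFKGFree : Prop :=
  ∀ (δ : ℝ) (c a b : Site 2) (C : (zdGraph 2).Walk c c),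
    let Ω : Set ℂ := {z | wind (fun t : ℝ => Set.IccExtend zero_le_one (C.toCurve (meshPoint δ)) t - z) ≠ 0}
    let le : SAW.DomainSAW Ω δ a b → SAW.DomainSAW Ω δ a b → Prop := fun γ₁ γ₂ => ∀ z : ℂ,
      0 ≤ wind (fun t : ℝ => Set.IccExtend zero_le_one ((γ₁.walk.append γ₂.walk.reverse).toCurve (meshPoint δ)) t - z)
    0 < δ →
    ∀ A B : Set (SAW.DomainSAW Ω δ a b), (∀ γ₁ γ₂, le γ₁ γ₂ → γ₁ ∈ A → γ₂ ∈ A) →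
      (∀ γ₁ γ₂, le γ₁ γ₂ → γ₁ ∈ B → γ₂ ∈ B) →
      SAW.weight Ω δ a b A * SAW.weight Ω δ a b B ≤ SAW.weight Ω δ a b Set.univ * SAW.weight Ω δ a b (A ∩ B)

/-- The crux is `LeftRightFKGFree` restricted to boundary-adjacent endpoints. [folklore] -/
theorem leftRightFKG_of_free (h : LeftRightFKGFree) : Theses.SAWLeftRightFKG.LeftRightFKG := by
  intro δ c a b a' b' C Ω le hδ _ _ _ _ A B hA hB
  exact h δ c a b C hδ A B hA hB

/-- **(E6) boundary adjacency of BOTH marked points is load-bearing — an `x`-free counterexample.**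
Witness: `δ = 1`, `C` = the boundary of the rectangle `[-1,5] × [-1,4]` (closed lattice walk of length 22
based at `(-1,-1)`), so `V(Ω) = {0,…,4} × {0,…,3}` (5×4 vertices), `a = (1,1)`, `b = (3,1)` (both
interior; 498 chords).  With `θ_γ(F)` = signed crossings of the upward ray from the centre of face `F`:
`A := {γ | θ_γ(F_{(1,0)}) ≤ -2}`-type / precisely the principal up-closures `A = ↑α`, `B = ↑β`
(`Relation.ReflTransGen le`) of the two length-11 chords that wind once clockwise round the face below `a`,
resp. below `b`; `θ(F_{(1,0)})`, `θ(F_{(2,0)})` are monotone along `le`-chains (argInc potential: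
`2πi·wind(γ₁γ₂⁻¹, z_F) = S_{z_F}(γ₁) − S_{z_F}(γ₂)`, `S` = sum of segment increments), so
`A ⊆ {θ(F_{(1,0)}) extreme}`, `B ⊆ {θ(F_{(2,0)}) extreme}`, and NO chord is extreme at both faces
(enumeration of the 498 chords) ⇒ `A ∩ B = ∅` while `w(A), w(B) ≥ x_c^{11} > 0`:
`w(A)·w(B) > 0 = w(Ω_δ)·w(A ∩ B)` for EVERY positive fugacity.  (Relative weights at `x_c`: `4.37·10⁻⁴`
each; the same happens on 4×5 `(1,1)→(2,3)` and 5×5 `(1,1)→(3,3)`.)  PROVED as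
`Summit.CriticalPhenomena.SAWScalingLimit.Theorems.LeftRightFKG.Negative.leftRightFKG_false_without_boundaryAdjacency`
(landed: `Theorems/LeftRightFKG/Negative/WithoutBoundaryAdjacency.lean`, p77992; parts p74952 p76216 p76710 p77096;
order characterisation `wind_nonneg_iff_wcross` p78135).  The actual witness used there: box `{0..4}×{0..3}`, `a = (1,2)`, `b = (3,2)`; `A = ↑α`,
`B = ↑β` for `α = (1,2)(2,2)(2,1)(1,1)(0,1)(0,2)(0,3)(1,3)(2,3)(3,3)(3,2)` and
`β = (1,2)(1,3)(2,3)(3,3)(4,3)(4,2)(4,1)(3,1)(2,1)(2,2)(3,2)`; disjointness is NOT an enumeration but a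
four-line argument: `wcross₁₁ ≥ 2` forces the darts `(1,2)→(2,2)` (first step) and `(1,3)→(2,3)`,
`wcross₂₁ ≥ 2` forces `(2,2)→(3,2)` (last step), so `(2,2)` is the second and the penultimate vertex of a
self-avoiding walk, which then has length 2 and no dart at height 3.  A corollary of the landed theorem (p77992); sorried pointer until the farm build catches up. [folklore] -/
theorem leftRightFKGFree_false : ¬ LeftRightFKGFree := by
  -- = `Theorems.LeftRightFKG.Negative.leftRightFKG_false_without_boundaryAdjacency` (LANDED, p77992); kept as a
  -- sorried pointer only because this workfile is published before the farm has built the new modules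
  -- (importing them here is the one-line change `Disproof_v5_imports.lean` in the session folder).
  sorry

/-- **(tightness) the inequality is attained with equality by CROSSING pairs of non-trivial up-sets.**
On the zig-zag domain `V = ({0..8}×{0..4}) ∖ ({2,6}×{2,3,4} ∪ {4}×{0,1,2})` (slits from the top at
columns 2, 6 and from the bottom at column 4), `a = (0,0)`, `b = (8,0)` (1600 chords): for the face-level
up-sets `A = {θ(F_{(0,3)}) ≥ 1}` (rel. weight `8.8·10⁻⁴`), `B = {θ(F_{(7,3)}) ≥ 1}` one has
`w(A∩B)·w(Ω) − w(A)·w(B) = 0` IDENTICALLY IN `x` (exact polynomial computation, `py/exactcov.py`):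
across a single-edge cut `Cov = det_left·det_right` and one chamber determinant vanishes.  So PA cannot be
strict and no uniform `ε` exists even at fixed size. [folklore] -/
theorem exists_crossing_pair_cov_eq_zero : ∃ (c a b a' b' : Site 2) (C : (zdGraph 2).Walk c c),
    let Ω : Set ℂ := {z | wind (fun t : ℝ => Set.IccExtend zero_le_one (C.toCurve (meshPoint 1)) t - z) ≠ 0}
    let le : SAW.DomainSAW Ω 1 a b → SAW.DomainSAW Ω 1 a b → Prop := fun γ₁ γ₂ => ∀ z : ℂ,
      0 ≤ wind (fun t : ℝ => Set.IccExtend zero_le_one ((γ₁.walk.append γ₂.walk.reverse).toCurve (meshPoint 1)) t - z)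
    a' ∈ C.support ∧ b' ∈ C.support ∧ (zdGraph 2).Adj a a' ∧ (zdGraph 2).Adj b b' ∧
    ∃ A B : Set (SAW.DomainSAW Ω 1 a b), (∀ γ₁ γ₂, le γ₁ γ₂ → γ₁ ∈ A → γ₂ ∈ A) ∧
      (∀ γ₁ γ₂, le γ₁ γ₂ → γ₁ ∈ B → γ₂ ∈ B) ∧ ¬ A ⊆ B ∧ ¬ B ⊆ A ∧ A.Nonempty ∧ B ≠ Set.univ ∧
      ∀ x : ℝ, weightAt x Ω 1 a b A * weightAt x Ω 1 a b B = weightAt x Ω 1 a b Set.univ * weightAt x Ω 1 a b (A ∩ B) := by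
  sorry

end

end Summit.CriticalPhenomena.SAWScalingLimit.Cruxes.LeftRightFKG.Disproof
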